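import Mathlib
import Summits.Ventures.PercRepro2.Defs
import Summits.Ventures.PercRepro2.HullDefs

/-!
# The down-set lemma: a monotone bijection from a down-set of the cube onto its complement-image
(blind cell PercRepro2, night-4 g2, 2026-08-24T05:0xZ; own proof)

For a finite ground set `U` and a family `S` of subsets of `U` closed under taking subsets (a
DOWN-SET), there is an injection `f` on `S` with `c ⊆ f c ⊆ U` and `U \ f c ∈ S` for every `c ∈ S`:
a bijection from `S` onto its complement-image `{U \ c | c ∈ S}` that only ADDS elements
(`exists_injOn_of_isDownset`).  Proof: induction on `U`.  For `U = insert a U'` split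
`S₀ = {c ∈ S | a ∉ c}` and `S₁ = {c ∈ S₀ | insert a c ∈ S}` (down-sets on `U'`, `S₁ ⊆ S₀`), take the
inductive maps `f₀`, `f₁` and set `f (insert a c) = insert a (f₀ c)` for `c ∈ S₁`, `f c = f₁ c` for
`c ∈ S₁`, `f c = insert a (f₀ c)` for `c ∈ S₀ \ S₁`.

Configuration form (`Config E`, red = `true`, `Hull.blue` the colour swap): a down-set `S` of
configurations admits an injection `f` with `ζ ≤ f ζ` and `blue (f ζ) ∈ S`
(`exists_injOn_config_of_isDownset`).  Use in the cell (night-4, proofs/NIGHT4-MONO.md): the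
MONOTONE form of the BL-local injection of (LOC0) inside one class `(C_B(l), colouring off the
blue cluster)`, and the graph statement (MONO-P): on a connected graph with a root `k` and a vertex
`o`, the colourings whose blue part together with the root edges spans the graph inject
monotonically into those whose red part together with the root edges joins `o` to `k`.
-/

namespace Summit.Ventures.PercRepro2

namespace Downset

variable {α : Type*} [DecidableEq α]

/-- A family of finsets closed under taking subsets. -/
def IsDownset (S : Finset (Finset α)) : Prop := ∀ c ∈ S, ∀ c' ⊆ c, c' ∈ S

/-- The inductive claim: an injection `f` on the down-set `S` with `c ⊆ f c ⊆ U` and `U \ f c ∈ S`. -/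
def Claim (U : Finset α) (S : Finset (Finset α)) : Prop :=
  ∃ f : Finset α → Finset α, Set.InjOn f ↑S ∧ ∀ c ∈ S, c ⊆ f c ∧ f c ⊆ U ∧ U \ f c ∈ S

/-- `(insert a U) \ insert a X = U \ X` when `a ∉ U`. -/
lemma insert_sdiff_insert_of_notMem {a : α} {U X : Finset α} (ha : a ∉ U) :
    insert a U \ insert a X = U \ X := by
  ext x
  simp only [Finset.mem_sdiff, Finset.mem_insert, not_or]
  constructor
  · rintro ⟨hx | hx, hxa, hxX⟩
    · exact absurd hx hxa
    · exact ⟨hx, hxX⟩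
  · rintro ⟨hx, hxX⟩
    exact ⟨Or.inr hx, fun h => ha (h ▸ hx), hxX⟩

/-- `(insert a U) \ X = insert a (U \ X)` when `a ∉ X`. -/
lemma insert_sdiff_of_notMem {a : α} {U X : Finset α} (ha : a ∉ X) :
    insert a U \ X = insert a (U \ X) := by
  ext x
  simp only [Finset.mem_sdiff, Finset.mem_insert]
  constructor
  · rintro ⟨hx | hx, hxX⟩
    · exact Or.inl hx
    · exact Or.inr ⟨hx, hxX⟩
  · rintro (rfl | ⟨hx, hxX⟩)
    · exact ⟨Or.inl rfl, ha⟩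
    · exact ⟨Or.inr hx, hxX⟩

/-- **The down-set lemma** (inductive form). -/
theorem claim_of_isDownset (U : Finset α) :
    ∀ S : Finset (Finset α), IsDownset S → (∀ c ∈ S, c ⊆ U) → Claim U S := by
  induction U using Finset.induction_on with
  | empty =>
    intro S _ hU
    refine ⟨id, Set.injOn_id _, fun c hc => ?_⟩
    have hce : c = ∅ := Finset.subset_empty.1 (hU c hc)
    subst hce
    exact ⟨le_rfl, le_rfl, by simpa using hc⟩
  | insert a U' ha ih =>
    intro S hS hU
    -- the two sections
    set S₀ : Finset (Finset α) := S.filter (fun c => a ∉ c) with hS₀def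
    set S₁ : Finset (Finset α) := S₀.filter (fun c => insert a c ∈ S) with hS₁def
    have memS₀ : ∀ c, c ∈ S₀ ↔ c ∈ S ∧ a ∉ c := by
      intro c; simp [hS₀def]
    have memS₁ : ∀ c, c ∈ S₁ ↔ (c ∈ S ∧ a ∉ c) ∧ insert a c ∈ S := by
      intro c; simp [hS₁def, hS₀def]
    have hS₀down : IsDownset S₀ := by
      intro c hc c' hc'
      rw [memS₀] at hc ⊢
      exact ⟨hS c hc.1 c' hc', fun h => hc.2 (hc' h)⟩
    have hS₁down : IsDownset S₁ := by
      intro c hc c' hc'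
      rw [memS₁] at hc ⊢
      refine ⟨⟨hS c hc.1.1 c' hc', fun h => hc.1.2 (hc' h)⟩, ?_⟩
      exact hS _ hc.2 _ (Finset.insert_subset_insert a hc')
    have hS₀U : ∀ c ∈ S₀, c ⊆ U' := by
      intro c hc
      rw [memS₀] at hc
      intro x hx
      have := hU c hc.1 hx
      rw [Finset.mem_insert] at this
      rcases this with rfl | h
      · exact absurd hx hc.2
      · exact h
    have hS₁U : ∀ c ∈ S₁, c ⊆ U' := by
      intro c hc
      rw [memS₁] at hc
      exact hS₀U c ((memS₀ c).2 hc.1)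
    obtain ⟨f₀, hf₀inj, hf₀⟩ := ih S₀ hS₀down hS₀U
    obtain ⟨f₁, hf₁inj, hf₁⟩ := ih S₁ hS₁down hS₁U
    -- the combined map
    let f : Finset α → Finset α := fun c =>
      if a ∈ c then insert a (f₀ (c.erase a)) else if c ∈ S₁ then f₁ c else insert a (f₀ c)
    have f_of_mem : ∀ c, a ∈ c → f c = insert a (f₀ (c.erase a)) := by
      intro c hc; simp [f, hc]
    have f_of_S₁ : ∀ c, a ∉ c → c ∈ S₁ → f c = f₁ c := by
      intro c hc hc₁; simp [f, hc, hc₁]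
    have f_of_notS₁ : ∀ c, a ∉ c → c ∉ S₁ → f c = insert a (f₀ c) := by
      intro c hc hc₁; simp [f, hc, hc₁]
    -- membership facts for the three cases
    have erase_mem_S₁ : ∀ c ∈ S, a ∈ c → c.erase a ∈ S₁ := by
      intro c hc hac
      rw [memS₁]
      refine ⟨⟨hS c hc _ (Finset.erase_subset a c), Finset.notMem_erase a c⟩, ?_⟩
      rwa [Finset.insert_erase hac]
    have mem_S₀_of_notMem : ∀ c ∈ S, a ∉ c → c ∈ S₀ := by
      intro c hc hac; exact (memS₀ c).2 ⟨hc, hac⟩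
    have ha_f₀ : ∀ c ∈ S₀, a ∉ f₀ c := fun c hc h => ha ((hf₀ c hc).2.1 h)
    have ha_f₁ : ∀ c ∈ S₁, a ∉ f₁ c := fun c hc h => ha ((hf₁ c hc).2.1 h)
    have eraseS₀ : ∀ c ∈ S, a ∈ c → c.erase a ∈ S₀ := fun c hc hac =>
      (memS₀ _).2 ((memS₁ _).1 (erase_mem_S₁ c hc hac)).1
    refine ⟨f, ?_, ?_⟩
    · -- injectivity
      intro c hc d hd hcd
      simp only [Finset.mem_coe] at hc hd
      by_cases hac : a ∈ c <;> by_cases had : a ∈ d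
      · rw [f_of_mem c hac, f_of_mem d had] at hcd
        have h1 : f₀ (c.erase a) = f₀ (d.erase a) := by
          have := congrArg (fun X => X.erase a) hcd
          simpa [Finset.erase_insert (ha_f₀ _ (eraseS₀ c hc hac)),
            Finset.erase_insert (ha_f₀ _ (eraseS₀ d hd had))] using this
        have h2 : c.erase a = d.erase a :=
          hf₀inj (Finset.mem_coe.2 (eraseS₀ c hc hac)) (Finset.mem_coe.2 (eraseS₀ d hd had)) h1
        rw [← Finset.insert_erase hac, ← Finset.insert_erase had, h2]
      · exfalso
        by_cases hd₁ : d ∈ S₁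
        · rw [f_of_mem c hac, f_of_S₁ d had hd₁] at hcd
          exact ha_f₁ d hd₁ (hcd ▸ Finset.mem_insert_self a _)
        · rw [f_of_mem c hac, f_of_notS₁ d had hd₁] at hcd
          have hdS₀ := mem_S₀_of_notMem d hd had
          have h1 : f₀ (c.erase a) = f₀ d := by
            have := congrArg (fun X => X.erase a) hcd
            simpa [Finset.erase_insert (ha_f₀ _ (eraseS₀ c hc hac)),
              Finset.erase_insert (ha_f₀ _ hdS₀)] using this
          have h2 : c.erase a = d :=
            hf₀inj (Finset.mem_coe.2 (eraseS₀ c hc hac)) (Finset.mem_coe.2 hdS₀) h1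
          exact hd₁ (h2 ▸ erase_mem_S₁ c hc hac)
      · exfalso
        by_cases hc₁ : c ∈ S₁
        · rw [f_of_mem d had, f_of_S₁ c hac hc₁] at hcd
          exact ha_f₁ c hc₁ (hcd ▸ Finset.mem_insert_self a _)
        · rw [f_of_mem d had, f_of_notS₁ c hac hc₁] at hcd
          have hcS₀ := mem_S₀_of_notMem c hc hac
          have h1 : f₀ c = f₀ (d.erase a) := by
            have := congrArg (fun X => X.erase a) hcd
            simpa [Finset.erase_insert (ha_f₀ _ hcS₀),
              Finset.erase_insert (ha_f₀ _ (eraseS₀ d hd had))] using this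
          have h2 : c = d.erase a :=
            hf₀inj (Finset.mem_coe.2 hcS₀) (Finset.mem_coe.2 (eraseS₀ d hd had)) h1
          exact hc₁ (h2 ▸ erase_mem_S₁ d hd had)
      · by_cases hc₁ : c ∈ S₁ <;> by_cases hd₁ : d ∈ S₁
        · rw [f_of_S₁ c hac hc₁, f_of_S₁ d had hd₁] at hcd
          exact hf₁inj (Finset.mem_coe.2 hc₁) (Finset.mem_coe.2 hd₁) hcd
        · exfalso
          rw [f_of_S₁ c hac hc₁, f_of_notS₁ d had hd₁] at hcd
          exact ha_f₁ c hc₁ (hcd ▸ Finset.mem_insert_self a _)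
        · exfalso
          rw [f_of_notS₁ c hac hc₁, f_of_S₁ d had hd₁] at hcd
          exact ha_f₁ d hd₁ (hcd.symm ▸ Finset.mem_insert_self a _)
        · rw [f_of_notS₁ c hac hc₁, f_of_notS₁ d had hd₁] at hcd
          have hcS₀ := mem_S₀_of_notMem c hc hac
          have hdS₀ := mem_S₀_of_notMem d hd had
          have h1 : f₀ c = f₀ d := by
            have := congrArg (fun X => X.erase a) hcd
            simpa [Finset.erase_insert (ha_f₀ _ hcS₀), Finset.erase_insert (ha_f₀ _ hdS₀)] using this
          exact hf₀inj (Finset.mem_coe.2 hcS₀) (Finset.mem_coe.2 hdS₀) h1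
    · -- the three properties
      intro c hc
      by_cases hac : a ∈ c
      · have hce := erase_mem_S₁ c hc hac
        have hceS₀ : c.erase a ∈ S₀ := (memS₀ _).2 ((memS₁ _).1 hce).1
        obtain ⟨h1, h2, h3⟩ := hf₀ _ hceS₀
        rw [f_of_mem c hac]
        refine ⟨?_, ?_, ?_⟩
        · calc c = insert a (c.erase a) := (Finset.insert_erase hac).symm
            _ ⊆ insert a (f₀ (c.erase a)) := Finset.insert_subset_insert a h1
        · exact Finset.insert_subset_insert a h2
        · rw [insert_sdiff_insert_of_notMem ha]
          exact ((memS₀ _).1 h3).1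
      · by_cases hc₁ : c ∈ S₁
        · obtain ⟨h1, h2, h3⟩ := hf₁ c hc₁
          rw [f_of_S₁ c hac hc₁]
          refine ⟨h1, h2.trans (Finset.subset_insert a U'), ?_⟩
          have haf : a ∉ f₁ c := fun h => ha (h2 h)
          rw [insert_sdiff_of_notMem haf]
          exact ((memS₁ _).1 h3).2
        · have hcS₀ := mem_S₀_of_notMem c hc hac
          obtain ⟨h1, h2, h3⟩ := hf₀ c hcS₀
          rw [f_of_notS₁ c hac hc₁]
          refine ⟨h1.trans (Finset.subset_insert a _), Finset.insert_subset_insert a h2, ?_⟩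
          rw [insert_sdiff_insert_of_notMem ha]
          exact ((memS₀ _).1 h3).1

/-- **The down-set lemma.** A down-set `S` of subsets of `U` admits an injection `f` with
`c ⊆ f c ⊆ U` and `U \ f c ∈ S` for all `c ∈ S`: a bijection onto `{U \ c | c ∈ S}` that only
adds elements. -/
theorem exists_injOn_of_isDownset (U : Finset α) (S : Finset (Finset α)) (hS : IsDownset S)
    (hU : ∀ c ∈ S, c ⊆ U) :
    ∃ f : Finset α → Finset α, Set.InjOn f ↑S ∧ ∀ c ∈ S, c ⊆ f c ∧ f c ⊆ U ∧ U \ f c ∈ S :=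
  claim_of_isDownset U S hS hU


/-! ## Configuration form -/

section Config

variable {E : Type*} [Fintype E] [DecidableEq E]

/-- The red edge set of a configuration. -/
def redSet (ζ : Config E) : Finset E := Finset.univ.filter (fun e => ζ e = true)

/-- The configuration with red edge set `F`. -/
def ofRedSet (F : Finset E) : Config E := fun e => decide (e ∈ F)

omit [DecidableEq E] in
/-- Membership in the red set. -/
lemma mem_redSet {ζ : Config E} {e : E} : e ∈ redSet ζ ↔ ζ e = true := by
  simp [redSet]

/-- `redSet` of `ofRedSet`. -/
@[simp] lemma redSet_ofRedSet (F : Finset E) : redSet (ofRedSet F) = F := by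
  ext e; simp [redSet, ofRedSet]

/-- `ofRedSet` of `redSet`. -/
@[simp] lemma ofRedSet_redSet (ζ : Config E) : ofRedSet (redSet ζ) = ζ := by
  funext e
  simp only [ofRedSet, mem_redSet]
  cases ζ e <;> simp

/-- `redSet` is injective. -/
lemma redSet_injective : Function.Injective (redSet (E := E)) := by
  intro ζ η h
  rw [← ofRedSet_redSet ζ, ← ofRedSet_redSet η, h]

omit [DecidableEq E] in
/-- The pointwise order on configurations is inclusion of red sets. -/
lemma le_iff_redSet_subset {ζ η : Config E} : ζ ≤ η ↔ redSet ζ ⊆ redSet η := by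
  constructor
  · intro h e he
    rw [mem_redSet] at he ⊢
    have := h e
    rw [he] at this
    exact Bool.eq_true_of_true_le this
  · intro h e
    have := @h e
    rw [mem_redSet, mem_redSet] at this
    cases hζ : ζ e
    · exact Bool.false_le _
    · rw [this hζ]

/-- The red set of the colour swap is the complement. -/
lemma redSet_blue (ζ : Config E) : redSet (Hull.blue ζ) = Finset.univ \ redSet ζ := by
  ext e
  simp [redSet, Hull.blue]

/-- A down-set of configurations (for the pointwise order `false ≤ true`). -/
def IsDownsetConfig (S : Finset (Config E)) : Prop := ∀ ζ ∈ S, ∀ η, η ≤ ζ → η ∈ S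

/-- **The down-set lemma for configurations**: a down-set `S` of configurations admits an injection
`f` with `ζ ≤ f ζ` (red edges only added) and `blue (f ζ) ∈ S` (the colour swap of the image lies in
`S`) for every `ζ ∈ S`. -/
theorem exists_injOn_config_of_isDownset (S : Finset (Config E)) (hS : IsDownsetConfig S) :
    ∃ f : Config E → Config E, Set.InjOn f ↑S ∧ ∀ ζ ∈ S, ζ ≤ f ζ ∧ Hull.blue (f ζ) ∈ S := by
  set S' : Finset (Finset E) := S.image redSet with hS'
  have memS' : ∀ F, F ∈ S' ↔ ∃ ζ ∈ S, redSet ζ = F := by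
    intro F; simp [hS']
  have hdown : IsDownset S' := by
    intro F hF F' hF'
    obtain ⟨ζ, hζ, rfl⟩ := (memS' F).1 hF
    refine (memS' F').2 ⟨ofRedSet F', hS ζ hζ _ ?_, redSet_ofRedSet F'⟩
    rw [le_iff_redSet_subset, redSet_ofRedSet]
    exact hF'
  obtain ⟨f', hinj, hf'⟩ := exists_injOn_of_isDownset Finset.univ S' hdown
    (fun c _ => Finset.subset_univ c)
  refine ⟨fun ζ => ofRedSet (f' (redSet ζ)), ?_, ?_⟩
  · intro ζ hζ η hη h
    simp only [Finset.mem_coe] at hζ hη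
    have h1 : f' (redSet ζ) = f' (redSet η) := by
      have := congrArg redSet h
      simpa using this
    have hζ' : redSet ζ ∈ S' := (memS' _).2 ⟨ζ, hζ, rfl⟩
    have hη' : redSet η ∈ S' := (memS' _).2 ⟨η, hη, rfl⟩
    exact redSet_injective (hinj (Finset.mem_coe.2 hζ') (Finset.mem_coe.2 hη') h1)
  · intro ζ hζ
    have hζ' : redSet ζ ∈ S' := (memS' _).2 ⟨ζ, hζ, rfl⟩
    obtain ⟨h1, _, h3⟩ := hf' _ hζ'
    refine ⟨?_, ?_⟩
    · rw [le_iff_redSet_subset, redSet_ofRedSet]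
      exact h1
    · obtain ⟨η, hη, hηeq⟩ := (memS' _).1 h3
      have : η = Hull.blue (ofRedSet (f' (redSet ζ))) := by
        apply redSet_injective
        rw [redSet_blue, redSet_ofRedSet, hηeq]
      rw [← this]
      exact hη

end Config

/-! ## (MONO-P): the monotone injection of the free fibre at a root -/

section MonoP

variable {V : Type*} {E : Type*} [Fintype E] [DecidableEq E]

/-- The colourings whose BLUE edges together with the root edges (all blue) span the graph: the
root edges are blue and every vertex lies in the blue cluster of the root `k`. -/
def spanSrc (ends : E → Sym2 V) (k : V) : Set (Config E) :=
  {ζ | (∀ e, k ∈ ends e → ζ e = false) ∧ ∀ v, v ∈ cluster ends (Hull.blue ζ) k}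

/-- **(MONO-P)**: on any finite graph with a root `k` and a vertex `o`, there is an injection on the
colourings whose blue part (with the root edges) spans the graph which only ADDS red edges and
lands in the colourings whose red part (with the root edges, now red) joins `o` to `k`. -/
theorem exists_monoP (ends : E → Sym2 V) (k o : V) :
    ∃ f : Config E → Config E, Set.InjOn f (spanSrc ends k) ∧
      ∀ ζ ∈ spanSrc ends k, ζ ≤ f ζ ∧ (∀ e, k ∈ ends e → f ζ e = true) ∧
        o ∈ cluster ends (f ζ) k := by
  classical
  set S : Finset (Config E) := Finset.univ.filter (fun ζ => ζ ∈ spanSrc ends k) with hSdef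
  have memS : ∀ ζ, ζ ∈ S ↔ ζ ∈ spanSrc ends k := by
    intro ζ; simp [hSdef]
  have hdown : IsDownsetConfig S := by
    intro ζ hζ η hη
    rw [memS] at hζ ⊢
    refine ⟨fun e he => ?_, fun v => ?_⟩
    · have h1 := hζ.1 e he
      have h2 := hη e
      rw [h1] at h2
      revert h2
      cases η e <;> simp
    · have hb : Hull.blue ζ ≤ Hull.blue η := by
        intro e
        have h := hη e
        simp only [Hull.blue]
        revert h
        cases ζ e <;> cases η e <;> simp
      exact cluster_mono hb k (hζ.2 v)
  obtain ⟨f, hinj, hf⟩ := exists_injOn_config_of_isDownset S hdown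
  refine ⟨f, ?_, ?_⟩
  · intro ζ hζ η hη h
    exact hinj (Finset.mem_coe.2 ((memS ζ).2 hζ)) (Finset.mem_coe.2 ((memS η).2 hη)) h
  · intro ζ hζ
    obtain ⟨h1, h2⟩ := hf ζ ((memS ζ).2 hζ)
    rw [memS] at h2
    refine ⟨h1, fun e he => ?_, ?_⟩
    · have := h2.1 e he
      simpa [Hull.blue] using this
    · have := h2.2 o
      rwa [Hull.blue_blue] at this

end MonoP

end Downset

end Summit.Ventures.PercRepro2
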